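import Summits.HodgeConjecture.CorCM.MumfordTateRankSeven
import Summits.HodgeConjecture.CorCM.MumfordTateRankSixConverse
import Literature.AlgebraicGeometry.HodgeTheory.RealMultiplicationMumfordTateRank
import Literature.AlgebraicGeometry.HodgeTheory.RealMultiplicationHodgeGroupEqLefschetz
import Literature.AlgebraicGeometry.HodgeTheory.SimpleAbelianSurfacePowersHodgeClasses
import Literature.AlgebraicGeometry.HodgeTheory.NoTypeIVFactorProducts
import Literature.AlgebraicGeometry.Motives.HodgeLieOfAbelianVarietyBiproduct
import Summits.HodgeConjecture.CorCM.CMProductSimpleFactors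
import HarnessLib

/-!
# The rung `dim MT(H¹(X)) = 7`, converse for real multiplication: powers of a simple abelian surface with real
# multiplication have `t = 7`, no factor of type IV, `𝔷 = 0` and `ℚ`-SIMPLE Hodge Lie algebra

COR-CM (cell `pub-hodgecm2`, seat `b27` gen 40, count-neutral lane MT-RANK-SEVEN-SIMPLE; theorems only, no definition, no
named fact; UNCONDITIONAL — nothing here uses or asserts HC_CM).  The converse direction of the real-multiplication branch of
`CorCM/MumfordTateRankSevenSimpleHodge`: for `B` a SIMPLE complex abelian SURFACE with `dim_ℚ End⁰B = 2` (then `End⁰B` is a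
real quadratic field, the tree's `isTotallyReal_endField_of_surface`) and `X ∼ B^{m+1}`:

* **`mtRank_hodge_one_eq_seven_of_isIsogenous_powSucc_rmSurface`** — `dim MT(H¹X) = 7`, `X` has no factor of type IV,
  `Lie Hg ∩ End_Hdg = 0`, `X` is not of CM type and is stably nondegenerate.  Ingredients: Ribet's rank formula
  `dim MT(H¹B) = 3 dim B + 1 = 7` (`HodgeTheory/RealMultiplicationMumfordTateRank`); `dim Lie Hg(H¹(⨁ B)) ≤ dim Lie Hg(H¹B)`;
  no type IV (`hasNoTypeIVFactor_of_isTotallyReal`, isogeny/powers) ⟹ `t ∉ {2,3,5,6,8}` (gen 36), and `t ≠ 4` because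
  `Z(End⁰X) ≅ End⁰B` has degree `2` (rung `t = 4`: centre `ℚ`).
* **`isSimple_hodgeLie_of_isIsogenous_powSucc_rmSurface`** — `Lie Hg(H¹X)` is a SIMPLE Lie algebra over `ℚ`: otherwise gen 39's
  dichotomy splits `X ∼ B₁^{a+1} × B₂^{b+1}` with `Z(End⁰B₁) = ℚ`, while the simple factor `B₁ ≼ X ∼ ⨁ B` is isogenous to `B`
  (uniqueness of simple factors), whose `End⁰` is a quadratic field.

## References
* [Ribet1983] K. A. Ribet, Amer. J. Math. 105 (1983), Thm. 0–1. [cite: Ribet1983, Thm. 0–1]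
* [MoonenZarhin1999LowDim] B. Moonen, Yu. Zarhin, Math. Ann. 315 (1999), §1, §2 (2.2), §3 (3.1). [cite: MoonenZarhin1999LowDim, §2 (2.2)]
* [MumfordAV1970] D. Mumford, *Abelian Varieties* (1970), §19 Thm. 1, Cor. 1–2 (pp. 173–174). [cite: MumfordAV1970, §19 Cor. 1–2 of Thm. 1 (pp. 173–174)]
-/

noncomputable section

open scoped TensorProduct
open CategoryTheory CategoryTheory.Limits Module

namespace Summit.HodgeConjecture.CorCM

open Literature.AlgebraicGeometry.Motives
open Literature.AlgebraicGeometry.Motives.AbelianVariety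
open Literature.AlgebraicGeometry.Motives.HodgeStructure
open Literature.AlgebraicGeometry.HodgeTheory
open Literature.AlgebraicGeometry.ComplexMultiplication (EndField isIsogenous_biproduct_powSucc)
open Literature.AlgebraicGeometry.Milne1999 (IsOfCMType)
open Literature.AlgebraicGeometry.Pohlmann1968 (isIsogenous_powSucc_biproduct)
open Summit.HodgeConjecture.CorCM.Domination
open Summit.HodgeConjecture.CorCM.SliceExhaustion (avDominatedBy_prod_left)

variable [HodgeTensorFacts.{0, 0}] {X : AbelianVariety ℂ} {n : ℕ}

/-- **Powers of a simple abelian surface with real multiplication: `dim MT(H¹X) = 7`, no factor of type IV, `𝔷 = 0`, not CM,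
stably nondegenerate** (`X ∼ B^{m+1}`, `B` simple, `dim B = 2 = dim_ℚ End⁰B`). [cite: Ribet1983, Thm. 0–1]
[cite: MoonenZarhin1999LowDim, §1 and §2 (2.2)] [cite: MumfordAV1970, §19 Cor. 1–2 of Thm. 1 (pp. 173–174)] -/
theorem mtRank_hodge_one_eq_seven_of_isIsogenous_powSucc_rmSurface (hX : IsSmoothProjective n X.X)
    {B : AbelianVariety ℂ} (hBs : B.IsSimple) (hB2 : B.dim = 2) (hE2 : Module.finrank ℚ B.endAlgebra = 2) {m : ℕ}
    (hXB : IsIsogenous X (B.powSucc m)) :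
    haveI := BettiUniverse.finite hX 1
    (BettiUniverse.hodge exists_isReal_hodgeModel_holds hX 1).mtRank = 7 ∧ HasNoTypeIVFactor X ∧
      (BettiUniverse.hodge exists_isReal_hodgeModel_holds hX 1).hodgeLie ⊓
        Subalgebra.toSubmodule (BettiUniverse.hodge exists_isReal_hodgeModel_holds hX 1).endAlg = ⊥ ∧
      ¬ IsOfCMType X ∧ IsStablyNondegenerate X := by
  classical
  have hn : X.dim = n := schemeDim_eq_holds hX
  subst hn
  haveI := BettiUniverse.finite hX 1
  have hB0 : 0 < B.dim := by omega
  have hF : IsField B.endAlgebra := AbelianVariety.isField_endAlgebra_of_isSimple_of_finrank_eq_two hBs hB0 hE2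
  haveI : NumberField.IsTotallyReal (EndField B hF) := AbelianVariety.isTotallyReal_endField_of_surface hB2 hE2 hF
  have hdeg : Module.finrank ℚ B.endAlgebra = B.dim := by rw [hE2, hB2]
  -- `X ∼ ⨁ B`, dimensions
  have hXP : IsIsogenous X (⨁ fun _ : Fin (m + 1) => B) := hXB.trans (isIsogenous_powSucc_biproduct B m)
  have h0 : 0 < X.dim := by
    obtain ⟨f, hf⟩ := hXP
    rw [dim_eq_of_isIsogeny hf, AndreRiemann.dim_biproduct_const]; positivity
  -- no type IV, `𝔷 = 0`
  have hA4 : HasNoTypeIVFactor X := (hasNoTypeIVFactor_of_isTotallyReal B hF).of_isIsogenous_powSucc hXB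
  have hz := hodgeLie_hodge_one_inf_endAlg_eq_bot_of_hasNoTypeIVFactor hX hA4
  -- `dim Lie Hg(H¹X) ≤ dim Lie Hg(H¹B) = 6`
  have hB' := AbelianVariety.isSmoothProjective_holds (A := B)
  have hP' := AbelianVariety.isSmoothProjective_holds (A := ⨁ fun _ : Fin (m + 1) => B)
  haveI := BettiUniverse.finite hB' 1
  haveI := BettiUniverse.finite hP' 1
  obtain ⟨h7B, h6B⟩ := mtRank_hodge_one_of_isTotallyReal' hF hB' hdeg
  have hle : Module.finrank ℚ (BettiUniverse.hodge exists_isReal_hodgeModel_holds hX 1).hodgeLie ≤ 6 := by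
    rw [AbelianVariety.finrank_hodgeLie_hodge_one_eq_of_isIsogenous hX hP' hXP]
    have h := AbelianVariety.finrank_hodgeLie_hodge_one_biproduct_const_le hB' hP' (a := m)
    rw [h6B, hB2] at h
    exact h
  have ht := mtRank_hodge_one_eq_finrank_hodgeLie_add_one hX h0
  have ht7 : (BettiUniverse.hodge exists_isReal_hodgeModel_holds hX 1).mtRank ≤ 7 := by rw [ht]; omega
  obtain ⟨h2', h3', h5', h6', -⟩ := mtRank_hodge_one_ne_of_hasNoTypeIVFactor hX h0 hA4
  have h2le := two_le_mtRank_hodge_one hX h0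
  -- not CM: `Lie Hg ≠ 0` forces a non-zero derived algebra (`𝔷 = 0`)
  have hcm4 : (BettiUniverse.hodge exists_isReal_hodgeModel_holds hX 1).mtRank ≠ 1 := by omega
  have hncm : ¬ IsOfCMType X := by
    intro hcm
    have hder := (isOfCMType_iff_hodgeLie_derived_eq_bot hX).1 hcm
    rw [hodgeLie_hodge_one_derived_eq_of_hasNoTypeIVFactor hX hA4] at hder
    rw [hder, finrank_bot] at ht
    omega
  -- `t ≠ 4`: the centre of `End⁰X ≅ M_{m+1}(End⁰B)` is the quadratic field `End⁰B`
  have ht4 : (BettiUniverse.hodge exists_isReal_hodgeModel_holds hX 1).mtRank ≠ 4 := by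
    intro h4
    have hZ1 := finrank_center_endAlgebra_eq_one_of_not_isOfCMType hX h0 hncm h4.le
    obtain ⟨e0⟩ := hXP.nonempty_endAlgebra_algEquiv
    obtain ⟨e1, -⟩ := CMProductEnd.nonempty_algEquiv_center_of_algEquiv e0
    obtain ⟨e2⟩ := CMProductEnd.nonempty_algEquiv_center_endAlgebra_biproduct_of_comm (B := B) (m := m + 1)
      (Nat.succ_pos m) hF.mul_comm
    have h := (e1.trans e2).toLinearEquiv.finrank_eq
    rw [hZ1, hE2] at h
    exact absurd h (by norm_num)
  have ht7' : (BettiUniverse.hodge exists_isReal_hodgeModel_holds hX 1).mtRank = 7 := by omega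
  exact ⟨ht7', hA4, hz, hncm,
    ((AbelianVariety.isStablyNondegenerate_of_isSimple_surface B hBs hB2).powSucc m).of_isIsogenous hXB⟩

/-- **The Hodge Lie algebra of a power of a simple abelian surface with real multiplication is a SIMPLE Lie algebra over
`ℚ`** (a `ℚ`-form of `𝔰𝔩₂ × 𝔰𝔩₂` without proper ideals: `Res_{K/ℚ} 𝔰𝔩₂`): by gen 39's dichotomy the alternative is the split
shape `X ∼ B₁^{a+1} × B₂^{b+1}` with `Z(End⁰B₁) = ℚ`; but the simple factor `B₁` of `X ∼ ⨁ B` is isogenous to `B`, whose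
endomorphism algebra is a quadratic field. [cite: MoonenZarhin1999LowDim, §2 (2.2) and §3 (3.1)]
[cite: MumfordAV1970, §19 Thm. 1, Cor. 1–2 (pp. 173–174)] -/
theorem isSimple_hodgeLie_of_isIsogenous_powSucc_rmSurface (hX : IsSmoothProjective n X.X)
    {B : AbelianVariety ℂ} (hBs : B.IsSimple) (hB2 : B.dim = 2) (hE2 : Module.finrank ℚ B.endAlgebra = 2) {m : ℕ}
    (hXB : IsIsogenous X (B.powSucc m)) :
    haveI := BettiUniverse.finite hX 1
    letI : LieRing (Module.End ℚ (bettiCohomology X.X 1)) := LieRing.ofAssociativeRing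
    ∀ 𝔏 : LieSubalgebra ℚ (Module.End ℚ (bettiCohomology X.X 1)),
      𝔏.toSubmodule = (BettiUniverse.hodge exists_isReal_hodgeModel_holds hX 1).hodgeLie → LieAlgebra.IsSimple ℚ 𝔏 := by
  classical
  haveI := BettiUniverse.finite hX 1
  obtain ⟨h7, -, hz, -, -⟩ := mtRank_hodge_one_eq_seven_of_isIsogenous_powSucc_rmSurface hX hBs hB2 hE2 hXB
  have hB0 : 0 < B.dim := by omega
  have hF : IsField B.endAlgebra := AbelianVariety.isField_endAlgebra_of_isSimple_of_finrank_eq_two hBs hB0 hE2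
  have hXP : IsIsogenous X (⨁ fun _ : Fin (m + 1) => B) := hXB.trans (isIsogenous_powSucc_biproduct B m)
  have h0 : 0 < X.dim := by
    obtain ⟨f, hf⟩ := hXP
    rw [dim_eq_of_isIsogeny hf, AndreRiemann.dim_biproduct_const]; positivity
  rcases isSimple_or_exists_isIsogenous_powSucc_prod_powSucc_of_center_eq_bot_of_mtRank_eq_seven hX h0 hz h7 with h | h
  · exact h
  · exfalso
    obtain ⟨B₁, B₂, a, b, hB₁s, -, hB₁0, -, -, -, -, -, -, hZ₁, -, -, -, -, -, hXB12, -, -⟩ := h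
    -- `B₁ ≼ X ≼ ⨁ B`, so `B₁ ∼ B`
    obtain ⟨g, hg⟩ := hXB12
    obtain ⟨f, hf⟩ := hXP
    have hdom : AVDominatedBy B₁ (⨁ fun _ : Fin (m + 1) => B) :=
      ((((avDominatedBy_powSucc_of_le B₁ (Nat.zero_le a)).trans (avDominatedBy_prod_left _ _)).trans_isIsogeny_inv
        hg).trans_isIsogeny_hom hf)
    obtain ⟨-, hB₁B⟩ := exists_isIsogenous_of_isSimple_of_avDominatedBy_biproduct (fun _ => hBs) hB₁s hB₁0 hdom
    -- centres: `1 = dim Z(End⁰B₁) = dim Z(End⁰B) = dim End⁰B = 2`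
    obtain ⟨e0⟩ := hB₁B.nonempty_endAlgebra_algEquiv
    obtain ⟨e1, -⟩ := CMProductEnd.nonempty_algEquiv_center_of_algEquiv e0
    have htop : Subalgebra.center ℚ B.endAlgebra = ⊤ :=
      le_antisymm le_top fun x _ => Subalgebra.mem_center_iff.2 fun y => hF.mul_comm y x
    have h := e1.toLinearEquiv.finrank_eq
    rw [hZ₁, htop, Subalgebra.topEquiv.toLinearEquiv.finrank_eq, hE2] at h
    exact absurd h (by norm_num)

end Summit.HodgeConjecture.CorCM

end
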